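import Summits.NavierStokesRegularity.FluidComputer.ClayBlowupForcedAlignmentOne
import Summits.NavierStokesRegularity.FluidComputer.ClayBlowupForcedAxisDecay
import HarnessLib

/-!
# GIGA–MIURA WITH THE CLAY FORCE: a Type I Clay blow-up — WITH its Clay force, at any viscosity —
# cannot have continuously aligned vorticity directions (the `X.f = 0` scope of g8's row removed)

Cell `ns-blowup`, seat `ns-blowup-ecbridge-2` (g10; the E–C endpoint theory seat). LABEL: E–C typing
(KERNEL — no named fact). WHAT THIS IS NOT: not Navier–Stokes evidence — necessary conditions on the
TYPE `ClayBlowup ν` (no inhabitant is claimed anywhere). Companion memo: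
`run/shared/lean/pub/ns-blowup/ecbridge2/ECBRIDGE-2-MEMO-9.md`.

## Content

The viscosity-`1` theorem `ClayBlowup.not_scaledAlignment_of_typeI_one`
(`ClayBlowupForcedAlignmentOne.lean`) transported through the viscosity normalisation
`ClayBlowup.rescale` (Type I and (CA′) are invariant under `u ↦ a u(a t, x)`, the vorticity direction
being unchanged and `ν(T − a s) = (ν a)(T/a − s)`):

* `ClayBlowup.isTypeIBlowup_rescale`, `ClayBlowup.hasScaledContinuousAlignment_rescale` — the two
  transports;
* **`ClayBlowup.not_scaledAlignment_of_typeI`** — for EVERY Clay blow-up (`ν > 0`, ANY Clay force):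
  `IsTypeIBlowup X.u X.T → HasScaledContinuousAlignment ν X.T X.u → False` (Giga–Miura 2011 Thm 1.1
  under (CA′), WITH the force);
* **`ClayBlowup.not_continuousAlignment_of_typeI_forced`**, `not_typeI_of_continuousAlignment_forced`
  — g8's rows `not_continuousAlignment_of_typeI` / `not_typeI_of_continuousAlignment` WITHOUT the
  hypothesis `X.f = 0`: a Type I Clay blow-up has, for every `d > 0` and every modulus `η`, a time and
  two points of vorticity `> d` whose directions differ by MORE than `η(‖x − y‖)`; a continuously
  aligned Clay blow-up is Type II; `DesignedBlowup` / `Realisation` twins; (C)-reading.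

References: Y. Giga, H. Miura, Comm. Math. Phys. 303 (2011), Thm 1.1, Rem. 1.4
[cite: GigaMiura2011, Thm 1.1 and Rem. 1.4]; Koch–Nadirashvili–Seregin–Šverák, Acta Math. 203
(2009), Prop 6.1 [cite: KochNadirashviliSereginSverak2009, Prop 6.1]; C. L. Fefferman, (C)
[cite: FeffermanClay2006, (C)].
-/

noncomputable section

namespace Summit.NavierStokesRegularity.FluidComputer

open Set MeasureTheory Filter Topology Function Metric
open scoped ENNReal NNReal
open Literature.Analysis Literature.Analysis.FluidPDE
open Summit.NavierStokesRegularity.NavierStokesRegularity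

namespace ClayBlowup

variable {μ ν : ℝ} (X : ClayBlowup μ)

/-! ## §1 Transport of Type I and of (CA′) through the viscosity normalisation -/

/-- The time dilation `s ↦ a s` (`a > 0`) maps the left neighbourhood of `T/a` to that of `T`.
[folklore] -/
theorem tendsto_mul_left_nhdsLT {a T : ℝ} (ha : 0 < a) :
    Tendsto (fun s : ℝ => a * s) (𝓝[<] (T / a)) (𝓝[<] T) := by
  refine tendsto_nhdsWithin_iff.2 ⟨?_, ?_⟩
  · have h : Tendsto (fun s : ℝ => a * s) (𝓝 (T / a)) (𝓝 (a * (T / a))) :=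
      (continuous_const.mul continuous_id).tendsto _
    rw [mul_div_cancel₀ _ ha.ne'] at h
    exact h.mono_left nhdsWithin_le_nhds
  · filter_upwards [self_mem_nhdsWithin] with s hs
    have := mul_lt_mul_of_pos_left (mem_Iio.1 hs) ha
    rwa [mul_div_cancel₀ _ ha.ne'] at this

/-- **Type I is invariant under the viscosity normalisation**: if `‖u(t, x)‖ ≤ C/√(T − t)` near `T`
then the rescaled blow-up `a u(a t, x)` (`a = ν/μ`, lifespan `T/a`) obeys
`‖·‖ ≤ (a/√a) C/√(T/a − s)` near `T/a`. [cite: GigaMiura2011, §1 (Type I)] -/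
theorem isTypeIBlowup_rescale (hμ : 0 < μ) (hν : 0 < ν) (hI : IsTypeIBlowup X.u X.T) :
    IsTypeIBlowup (X.rescale hμ hν).u (X.rescale hμ hν).T := by
  obtain ⟨C, hC⟩ := hI
  set a : ℝ := ν / μ with ha
  have ha0 : 0 < a := div_pos hν hμ
  refine ⟨a / Real.sqrt a * C, ?_⟩
  rw [X.rescale_T hμ hν]
  filter_upwards [(tendsto_mul_left_nhdsLT (T := X.T) ha0).eventually hC, self_mem_nhdsWithin]
    with s hs hsT y
  rw [X.rescale_u_apply hμ hν, norm_smul, Real.norm_of_nonneg ha0.le]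
  have hlt : s < X.T / a := hsT
  have hpos : 0 < X.T / a - s := sub_pos.2 hlt
  have e1 : X.T - a * s = a * (X.T / a - s) := by field_simp
  have h1 := hs y
  rw [e1, Real.sqrt_mul ha0.le] at h1
  have hsa : 0 < Real.sqrt a := Real.sqrt_pos.2 ha0
  have hsD : 0 < Real.sqrt (X.T / a - s) := Real.sqrt_pos.2 hpos
  calc a * ‖X.u (a * s) y‖ ≤ a * (C / (Real.sqrt a * Real.sqrt (X.T / a - s))) :=
        mul_le_mul_of_nonneg_left h1 ha0.le
    _ = a / Real.sqrt a * C / Real.sqrt (X.T / a - s) := by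
        field_simp

/-- **(CA′) is invariant under the viscosity normalisation**: the vorticity of `a u(a t, ·)` is
`a curl u(a t, ·)`, with the SAME direction field; the threshold becomes `a d`, the rate `θ(a s)`, and
`μ(T − a s) = ν(T/a − s)` for `a = ν/μ`. [cite: GigaMiura2011, Rem. 1.4] -/
theorem hasScaledContinuousAlignment_rescale (hμ : 0 < μ) (hν : 0 < ν)
    (hCA : HasScaledContinuousAlignment μ X.T X.u) :
    HasScaledContinuousAlignment ν (X.rescale hμ hν).T (X.rescale hμ hν).u := by
  obtain ⟨d, hd, η, θ, hηm, hηc, hη0, hθ0, hθ, hal⟩ := hCA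
  set a : ℝ := ν / μ with ha
  have ha0 : 0 < a := div_pos hν hμ
  have haμ : μ * a = ν := by rw [ha]; field_simp
  have hT' : (X.rescale hμ hν).T = X.T / a := X.rescale_T hμ hν
  -- the rescaled slices and their vorticity
  have hslice : ∀ s, (X.rescale hμ hν).u s = fun y => a • X.u (a * s) y := fun s =>
    funext fun y => X.rescale_u_apply hμ hν s y
  have hmaps : ∀ s ∈ Ioo 0 (X.T / a), a * s ∈ Ioo 0 X.T := fun s hs =>
    ⟨mul_pos ha0 hs.1, by have := mul_lt_mul_of_pos_left hs.2 ha0; rwa [mul_div_cancel₀ _ ha0.ne'] at this⟩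
  have hcurl : ∀ s ∈ Ioo 0 (X.T / a), ∀ y,
      curl ((X.rescale hμ hν).u s) y = a • curl (X.u (a * s)) y := by
    intro s hs y
    rw [hslice]
    have hdiff : DifferentiableAt ℝ (X.u (a * s)) y :=
      ((X.classical.contDiff_velocity ⟨(hmaps s hs).1.le, (hmaps s hs).2⟩).differentiable
        (by norm_cast)) y
    exact curl_const_smul hdiff a
  have hdirn : ∀ s ∈ Ioo 0 (X.T / a), ∀ y,
      vorticityDirection (curl ((X.rescale hμ hν).u s)) y =
        vorticityDirection (curl (X.u (a * s))) y := by
    intro s hs y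
    have e : curl ((X.rescale hμ hν).u s) = fun y => a • curl (X.u (a * s)) (id y) :=
      funext (hcurl s hs)
    rw [e]
    exact vorticityDirection_const_smul_comp ha0 _ id y
  refine ⟨a * d, mul_pos ha0 hd, η, fun s => θ (a * s), hηm, hηc, hη0, fun s => hθ0 _, ?_, ?_⟩
  · rw [hT']
    exact hθ.comp (tendsto_mul_left_nhdsLT ha0)
  · intro s hs y y' hy hy'
    rw [hT'] at hs
    rw [hcurl s hs, norm_smul, Real.norm_of_nonneg ha0.le] at hy hy'
    have hy1 : d < ‖curl (X.u (a * s)) y‖ := lt_of_mul_lt_mul_left hy ha0.le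
    have hy1' : d < ‖curl (X.u (a * s)) y'‖ := lt_of_mul_lt_mul_left hy' ha0.le
    rw [hdirn s hs, hdirn s hs]
    have key := hal (a * s) (hmaps s hs) y y' hy1 hy1'
    have e : μ * (X.T - a * s) = ν * ((X.rescale hμ hν).T - s) := by
      rw [hT', ← haμ]; field_simp
    rwa [e] at key

/-! ## §2 Giga–Miura with the Clay force, every viscosity -/

/-- **GIGA–MIURA WITH THE CLAY FORCE** (`ν > 0`, ANY Clay force; no named fact): the Type I bound
and the scaled continuous alignment (CA′) of the vorticity directions are incompatible for a Clay
blow-up — Giga–Miura 2011, Thm 1.1 under Rem. 1.4, with the force (normalise the viscosity and apply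
`not_scaledAlignment_of_typeI_one`). [cite: GigaMiura2011, Thm 1.1 and Rem. 1.4] -/
theorem not_scaledAlignment_of_typeI (hμ : 0 < μ) (hI : IsTypeIBlowup X.u X.T)
    (hCA : HasScaledContinuousAlignment μ X.T X.u) : False :=
  (X.rescale hμ one_pos).not_scaledAlignment_of_typeI_one (X.isTypeIBlowup_rescale hμ one_pos hI)
    (X.hasScaledContinuousAlignment_rescale hμ one_pos hCA)

/-- **A TYPE I CLAY BLOW-UP — WITH ITS CLAY FORCE — HAS NO CONTINUOUSLY ALIGNED VORTICITY DIRECTIONS**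
(`ν > 0`; no named fact): for every vorticity threshold `d > 0` and every modulus of continuity `η`
(monotone and continuous on `[0, ∞)`, `η(0) = 0`) there are a time `t ∈ (0, T)` and two points of
vorticity magnitude `> d` whose directions differ by MORE than `η(‖x − y‖)`. Supersedes g8's
`not_continuousAlignment_of_typeI`, which needs `X.f = 0`. [cite: GigaMiura2011, Thm 1.1] -/
theorem not_continuousAlignment_of_typeI_forced (hμ : 0 < μ) (hI : IsTypeIBlowup X.u X.T)
    {d : ℝ} (hd : 0 < d) {η : ℝ → ℝ} (hηm : MonotoneOn η (Ici 0)) (hηc : ContinuousOn η (Ici 0))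
    (hη0 : η 0 = 0) :
    ∃ t ∈ Ioo 0 X.T, ∃ x y : EuclideanSpace ℝ (Fin 3),
      d < ‖curl (X.u t) x‖ ∧ d < ‖curl (X.u t) y‖ ∧
        η ‖x - y‖ <
          ‖vorticityDirection (curl (X.u t)) x - vorticityDirection (curl (X.u t)) y‖ := by
  by_contra hcon
  push Not at hcon
  exact X.not_scaledAlignment_of_typeI hμ hI
    (hasScaledContinuousAlignment_of_continuousAlignment hμ ⟨d, hd, η, hηm, hηc, hη0, hcon⟩)

/-- **A CONTINUOUSLY ALIGNED CLAY BLOW-UP IS TYPE II, WITH ITS CLAY FORCE** (`ν > 0`): if for some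
`d > 0` and modulus `η` the vorticity directions satisfy `‖ξ(t,x) − ξ(t,y)‖ ≤ η(‖x − y‖)` on
`{|ω(t,·)| > d}` for all `t ∈ (0, T)`, then `¬ IsTypeIBlowup u T`. Supersedes g8's
`not_typeI_of_continuousAlignment (hf : X.f = 0)`. [cite: GigaMiura2011, Thm 1.1] -/
theorem not_typeI_of_continuousAlignment_forced (hμ : 0 < μ) {d : ℝ} (hd : 0 < d)
    {η : ℝ → ℝ} (hηm : MonotoneOn η (Ici 0)) (hηc : ContinuousOn η (Ici 0)) (hη0 : η 0 = 0)
    (hCA : ∀ t ∈ Ioo 0 X.T, ∀ x y : EuclideanSpace ℝ (Fin 3),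
      d < ‖curl (X.u t) x‖ → d < ‖curl (X.u t) y‖ →
        ‖vorticityDirection (curl (X.u t)) x - vorticityDirection (curl (X.u t)) y‖ ≤ η ‖x - y‖) :
    ¬ IsTypeIBlowup X.u X.T := fun hI =>
  X.not_scaledAlignment_of_typeI hμ hI
    (hasScaledContinuousAlignment_of_continuousAlignment hμ ⟨d, hd, η, hηm, hηc, hη0, hCA⟩)

end ClayBlowup

/-! ## §3 `DesignedBlowup` twins and the (C)-reading -/

namespace DesignedBlowup

variable {ν : ℝ} (D : DesignedBlowup ν)

/-- **Giga–Miura WITH the force, for designed blow-ups**: Type I ⇒ no continuous alignment.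
[cite: GigaMiura2011, Thm 1.1] -/
theorem not_continuousAlignment_of_typeI_forced (hν : 0 < ν) (hI : IsTypeIBlowup D.u D.T)
    {d : ℝ} (hd : 0 < d) {η : ℝ → ℝ} (hηm : MonotoneOn η (Ici 0)) (hηc : ContinuousOn η (Ici 0))
    (hη0 : η 0 = 0) :
    ∃ t ∈ Ioo 0 D.T, ∃ x y : EuclideanSpace ℝ (Fin 3),
      d < ‖curl (D.u t) x‖ ∧ d < ‖curl (D.u t) y‖ ∧
        η ‖x - y‖ <
          ‖vorticityDirection (curl (D.u t)) x - vorticityDirection (curl (D.u t)) y‖ :=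
  D.toClayBlowup.not_continuousAlignment_of_typeI_forced hν hI hd hηm hηc hη0

/-- **A continuously aligned designed blow-up is Type II, WITH its force.** [cite: GigaMiura2011, Thm 1.1] -/
theorem not_typeI_of_continuousAlignment_forced (hν : 0 < ν) {d : ℝ} (hd : 0 < d)
    {η : ℝ → ℝ} (hηm : MonotoneOn η (Ici 0)) (hηc : ContinuousOn η (Ici 0)) (hη0 : η 0 = 0)
    (hCA : ∀ t ∈ Ioo 0 D.T, ∀ x y : EuclideanSpace ℝ (Fin 3),
      d < ‖curl (D.u t) x‖ → d < ‖curl (D.u t) y‖ →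
        ‖vorticityDirection (curl (D.u t)) x - vorticityDirection (curl (D.u t)) y‖ ≤ η ‖x - y‖) :
    ¬ IsTypeIBlowup D.u D.T :=
  D.toClayBlowup.not_typeI_of_continuousAlignment_forced hν hd hηm hηc hη0 hCA

end DesignedBlowup

namespace PalasekTowerClayBridge.Realisation

variable {ν : ℝ} {R : TowerRates} (W : Realisation ν R)

/-- **A Type I tower realisation — WITH its forcing — has no continuously aligned vorticity
directions** (`ν > 0`): Giga–Miura with the force, through `toDesignedBlowup`.
[cite: GigaMiura2011, Thm 1.1] -/
theorem not_continuousAlignment_of_typeI (hν : 0 < ν) (hI : IsTypeIBlowup W.u W.T)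
    {d : ℝ} (hd : 0 < d) {η : ℝ → ℝ} (hηm : MonotoneOn η (Ici 0)) (hηc : ContinuousOn η (Ici 0))
    (hη0 : η 0 = 0) :
    ∃ t ∈ Ioo 0 W.T, ∃ x y : EuclideanSpace ℝ (Fin 3),
      d < ‖curl (W.u t) x‖ ∧ d < ‖curl (W.u t) y‖ ∧
        η ‖x - y‖ <
          ‖vorticityDirection (curl (W.u t)) x - vorticityDirection (curl (W.u t)) y‖ :=
  W.toDesignedBlowup.not_continuousAlignment_of_typeI_forced hν hI hd hηm hηc hη0

/-- **A continuously aligned tower realisation is Type II, WITH its forcing** (`ν > 0`).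
[cite: GigaMiura2011, Thm 1.1] -/
theorem not_typeI_of_continuousAlignment (hν : 0 < ν) {d : ℝ} (hd : 0 < d)
    {η : ℝ → ℝ} (hηm : MonotoneOn η (Ici 0)) (hηc : ContinuousOn η (Ici 0)) (hη0 : η 0 = 0)
    (hCA : ∀ t ∈ Ioo 0 W.T, ∀ x y : EuclideanSpace ℝ (Fin 3),
      d < ‖curl (W.u t) x‖ → d < ‖curl (W.u t) y‖ →
        ‖vorticityDirection (curl (W.u t)) x - vorticityDirection (curl (W.u t)) y‖ ≤ η ‖x - y‖) :
    ¬ IsTypeIBlowup W.u W.T :=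
  W.toDesignedBlowup.not_typeI_of_continuousAlignment_forced hν hd hηm hηc hη0 hCA

end PalasekTowerClayBridge.Realisation

/-- **(C)-READING OF GIGA–MIURA WITH FORCE**: if Fefferman's (C) holds then at every `ν > 0` there is
a Clay blow-up, and it is NOT a Type I blow-up with (CA′)-aligned vorticity directions.
[cite: GigaMiura2011, Thm 1.1] [cite: FeffermanClay2006, (C)] -/
theorem breakdownR3_gigaMiura
    (h : Summit.NavierStokesRegularity.NavierStokesRegularity.NavierStokesBreakdownR3) {ν : ℝ}
    (hν : 0 < ν) :
    ∃ X : ClayBlowup ν, ¬ (IsTypeIBlowup X.u X.T ∧ HasScaledContinuousAlignment ν X.T X.u) := by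
  obtain ⟨X⟩ := forall_nonempty_clayBlowup_of_breakdownR3 h ν hν
  exact ⟨X, fun hh => X.not_scaledAlignment_of_typeI hν hh.1 hh.2⟩

end Summit.NavierStokesRegularity.FluidComputer

end
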